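import Summits.ResolutionOfSingularities.ResolutionOfSingularities.Theorems.MarkedTransferCampaignW46MohWindowShadeFormalStepZChart
import Summits.ResolutionOfSingularities.ResolutionOfSingularities.Theorems.WildConesCampaignW46RsopAdapted
import Summits.ResolutionOfSingularities.ResolutionOfSingularities.Theorems.WildConesCampaignW46ChartReindex
import Summits.ResolutionOfSingularities.ResolutionOfSingularities.Theorems.WildConesCampaignW46StalkChart
import Summits.ResolutionOfSingularities.ResolutionOfSingularities.Theorems.WildConesCampaignW46TransformStalk
import Summits.ResolutionOfSingularities.ResolutionOfSingularities.Theorems.MarkedTransferCampaignW46LiteralCentreProcrastination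
import Literature.AlgebraicGeometry.Resolution.BlowupOffCentre
import Literature.AlgebraicGeometry.Resolution.GenericPointStalkData
import Literature.AlgebraicGeometry.Resolution.AdicQuotient
import HarnessLib

/-!
# [OURS · L1 W4.6 rung (iii-2), FORMAL ENTRANCE DOOR, brick 2c] THE FORMAL STEP (scheme level): along a point blow-up of the typed
# procedure a formal anchor at the centre yields a formal anchor at every singular, residually rational point upstairs — with the model's
# `PointBlowup.step` in the Hauser–Wagner frame at an EQUIMULTIPLE point; off the centre the anchor is carried verbatim

Cell `res-hironaka`, LADDER-RESOLUTION rung L (D-0089), slot W4.6 rung (iii); seat res-L1-s46-pv-6 (gen 5). Host route MarkedTransfer,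
`--supports stmt-ResolutionOfSingularities-16155 --as helper`; kind proof (no definition).

WHAT.
* `exists_formalAnchor_step` — `π : Z′ → Z` the blow-up of an ambient datum along the reduced ideal of the closed point `ξ = π(ξ′) ∈ Sing(E)`,
  `E.b = p`, `𝒪_{Z,ξ}` of embedding dimension `3`, `ξ′ ∈ Sing(E′)` RESIDUALLY RATIONAL over `ξ` (hypothesis `hrat` — a parameter, so that the
  walk theorem can be stated for any perfect field; over an algebraically closed field it is res-L1-s46-pv-2's
  `exists_sub_stalkMap_mem_maximalIdeal_of_isClosed`), `J_ξ = (f₀)` formally anchored with model state `s`: then `J′_{ξ′} = (f′)` is formally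
  anchored with model state `PointBlowup.step p c b s` at an EQUIMULTIPLE translated point `b` of the chart `y_c` in the Hauser–Wagner frame
  (`b_c = 0`; the chart `y₁` only at its origin). Assembly of pv-2's bricks 13/6/10/12 (adapted r.s.p., Rees-chart stalk data, change of
  chart index, transform stalk) with bricks 2a/2b of this seat; the proof text follows pv-2's `ForcedAtom.exists_presentation_transform_of_isBlowup`
  WITHOUT its `Sing.Subsingleton` hypothesis (the point over the centre is given, as along a hit thread).
* `exists_formalAnchor_offCentre` — at a point NOT over the centre the stalk map is an isomorphism and the controlled transform is the total
  transform (tree `BlowupOffCentre`); Cohen coordinates are composed with the completed inverse (tree `adicCompletionCongr`).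
`K : Type`.

HONEST FRAMING. Nothing here is a statement of H. Hironaka's manuscript [Hironaka2017] (Def. 2.1 p.5, Th. 16.6 p.84 — scope only, under
adjudication) and nothing asserts that any statement of it holds. AI-written; AI review is weaker than expert review. No `sorry`; axioms
standard. References: Stacks Project Tag 0804 (blow-up charts); H. Matsumura, *Commutative Ring Theory* (1986), Thm. 8.11. [StacksProject]
[Matsumura1987] [folklore]
-/

noncomputable section

set_option linter.dupNamespace false -- mandated namespace of this single-conjunct summit

open IsLocalRing MvPolynomial

namespace Summit.ResolutionOfSingularities.ResolutionOfSingularities.Theorems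

namespace CampaignW46

namespace MohWindowShadeFormalStep

open Literature.AlgebraicGeometry.Resolution
open Literature.AlgebraicGeometry.Resolution.PointBlowup
open Literature.AlgebraicGeometry.Resolution.Hauser2010
open Literature.Barriers.ResolutionOfSingularities.HauserPerlega (natCast_le_ordZero_iff ordZero_ne_top ordZero_rename)
open CampaignW46.FormalChart
open CampaignW46.AtomGerm (hasSubst_chartGerm ringHom_eq_subst_chartGerm rename_chartSubst_self rename_chartSubst_of_ne
  exists_isUnit_image_adapted X_some_ne_zero kill_rename_some constantCoeff_rename_some mem_maximalIdeal_pow_iff_algebraMap)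
open Literature.RingTheory.MvPowerSeries.Jets (mem_maximalIdeal_iff_constantCoeff_eq_zero)
open Summit.ResolutionOfSingularities.ResolutionOfSingularities.Theorems.FrobeniusClosing (chartSubst)
open MohWindowShadeFormalAnchor (frame_apply isRegularLocalRing_S spanFinrank_S span_frame_eq_maximalIdeal eval₂_frame_eq_rename)
/-! ## §4 The formal step along a point blow-up of the typed procedure (scheme level) -/

section Scheme

open CategoryTheory AlgebraicGeometry TopologicalSpace
open Literature.AlgebraicGeometry.Hironaka2017.S02Preliminaries
open Literature.AlgebraicGeometry.Hironaka2017.Datum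
open Scheme.IdealSheafData
open CampaignW46.ChartPoint

variable {p : ℕ} [hp : Fact p.Prime] {K : Type} [Field K] [CharP K p] [PerfectRing K p] [DecidableEq K]

/-- Two letters: the complementary index. [folklore] -/
theorem exists_other_index (i₀ : Fin 2) : ∃ i₁ : Fin 2, i₁ ≠ i₀ ∧ ∀ l, l = i₀ ∨ l = i₁ := by
  have h01 : ∀ m : Fin 2, m = 0 ∨ m = 1 := fun m => by fin_cases m <;> simp
  rcases h01 i₀ with rfl | rfl
  · exact ⟨1, by decide, fun l => h01 l⟩
  · exact ⟨0, by decide, fun l => (h01 l).symm⟩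

/-- [OURS · L1 W4.6 rung (iii-2) — THE FORMAL STEP; replaces the role of «the transform `E′` of `E` by the blowup with center `D`»
(H. Hironaka, ms. 2017, Def. 2.1 p.5) for a FORMALLY ANCHORED window germ; NOT a statement of the manuscript] Let `π : Z′ → Z` be the
blow-up of an ambient datum along the reduced ideal of the closed point `ξ = π(ξ′) ∈ Sing(E)`, `E.b = p`, `𝒪_{Z,ξ}` of embedding dimension `3`,
`ξ′ ∈ Sing(E′)` a point of the transform RESIDUALLY RATIONAL over `ξ` (`hrat`; automatic for closed points over an algebraically closed
field), and let `J_ξ = (f₀)` carry a FORMAL ANCHOR `E₀(f₀) = w · (z^p + F(u₀, u₁))` with all monomials of `F` of degree `≥ p`. Then `J′_{ξ′}`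
carries a formal anchor whose model polynomial is the Hauser–Wagner STEP `(PointBlowup.step p c b s).F` at an EQUIMULTIPLE translated point
`b` of the chart `y_c` (`b_c = 0`; the chart `y₁` only at its origin). Assembly: adapted r.s.p. (pv-2 brick 13), chart data of the Rees-chart
stalk (pv-2 brick 6), change of chart to the Hauser–Wagner frame (pv-2 brick 10), exclusion of the `z`-chart origin (§3), and the ring-level
step (§2). [cite: StacksProject, Tag 0804] [cite: Matsumura1987, Thm. 8.11] -/
theorem exists_formalAnchor_step {A A' : AmbientDatum p K} (π : A'.Z ⟶ A.Z) (D : Closeds A.Z) (hπ : IsBlowup π (vanishingIdeal D))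
    {E : IdealExponent A.Z} (hb : E.b = p) {ξ' : A'.Z} (hD : (D : Set A.Z) = {π.base ξ'}) (hξ : π.base ξ' ∈ E.sing)
    (hξ' : ξ' ∈ (E.transform π D).sing) (h3 : (maximalIdeal (A.Z.presheaf.stalk (π.base ξ'))).spanFinrank = 3)
    (hrat : ∀ y : A'.Z.presheaf.stalk ξ', ∃ r : A.Z.presheaf.stalk (π.base ξ'),
      y - (π.stalkMap ξ').hom r ∈ maximalIdeal (A'.Z.presheaf.stalk ξ'))
    (E₀ : AdicCompletion (maximalIdeal (A.Z.presheaf.stalk (π.base ξ'))) (A.Z.presheaf.stalk (π.base ξ')) ≃+*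
      MvPowerSeries (Option (Fin 2)) K)
    {f₀ : A.Z.presheaf.stalk (π.base ξ')} (hJ : stalkIdeal E.J (π.base ξ') = Ideal.span {f₀}) {w : MvPowerSeries (Option (Fin 2)) K}
    (hw : IsUnit w) (s : State (Fin 2) K) (hdeg : ∀ d ∈ s.F.support, p ≤ d.degree)
    (hE₀ : E₀ (algebraMap _ _ f₀) = w * (MvPowerSeries.X none ^ p + MvPolynomial.eval₂ MvPowerSeries.C
      (fun l : Fin 2 => if l = (0 : Fin 2) then MvPowerSeries.X (some (0 : Fin 2)) else MvPowerSeries.X (some 1)) s.F)) :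
    ∃ (c : Fin 2) (b : Fin 2 → K) (E' : AdicCompletion (maximalIdeal (A'.Z.presheaf.stalk ξ')) (A'.Z.presheaf.stalk ξ') ≃+*
        MvPowerSeries (Option (Fin 2)) K) (f' : A'.Z.presheaf.stalk ξ') (w' : MvPowerSeries (Option (Fin 2)) K),
      b c = 0 ∧ (c = 1 → ∀ l, b l = 0) ∧ IsEquimultiplePoint p c b s ∧
      stalkIdeal (E.transform π D).J ξ' = Ideal.span {f'} ∧ IsUnit w' ∧
      E' (algebraMap _ _ f') = w' * (MvPowerSeries.X none ^ p + MvPolynomial.eval₂ MvPowerSeries.C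
        (fun l : Fin 2 => if l = (0 : Fin 2) then MvPowerSeries.X (some (0 : Fin 2)) else MvPowerSeries.X (some 1)) (step p c b s).F) := by
  classical
  haveI : IsLocallyNoetherian A'.Z := ambient_isLocallyNoetherian A'
  haveI : IsRegularLocalRing (A.Z.presheaf.stalk (π.base ξ')) := ambient_isRegular A _
  haveI : IsRegularLocalRing (A'.Z.presheaf.stalk ξ') := ambient_isRegular A' _
  set g := (π.stalkMap ξ').hom with hgdef
  have hloc : IsLocalHom g := inferInstance
  have hg : (maximalIdeal (A.Z.presheaf.stalk (π.base ξ'))).map g ≤ maximalIdeal (A'.Z.presheaf.stalk ξ') :=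
    ((IsLocalRing.local_hom_TFAE g).out 0 2).mp hloc
  -- an adapted regular system of parameters at `π ξ′`
  obtain ⟨c, hc, hcX⟩ := exists_rsop_adapted E₀
  have hcl : IsClosed ({π.base ξ'} : Set A.Z) := hD ▸ D.isClosed
  have hcJ : Ideal.span (Set.range c) = stalkIdeal (vanishingIdeal D) (π.base ξ') := by
    rw [hc, stalkIdeal_vanishingIdeal_eq_maximalIdeal_of_closure_eq]
    rw [hD, hcl.closure_eq]
  have hd' : (maximalIdeal (A.Z.presheaf.stalk (π.base ξ'))).spanFinrank = Fintype.card (Option (Fin 2)) := by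
    rw [h3]; simp
  obtain ⟨i, e, τ, he, hei, hnzd, hgen, -, hdim⟩ := exists_stalk_chartData_nzd hπ ξ' c hcJ hc hd' hrat
  -- `f₀ ∈ 𝔪^p`
  have hf₀𝔪 : f₀ ∈ maximalIdeal (A.Z.presheaf.stalk (π.base ξ')) ^ p := by
    have h := (le_idealOrder_iff E.J _ E.b).mp hξ
    rw [hJ, Ideal.span_singleton_le_iff_mem, hb] at h
    exact h
  -- the conclusion from chart data in a `u`-chart `some i₀` satisfying the Hauser–Wagner frame condition
  have tail : ∀ (i₀ : Fin 2) (e : Option (Fin 2) → A'.Z.presheaf.stalk ξ') (τ : Option (Fin 2) → A.Z.presheaf.stalk (π.base ξ')),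
      (∀ j, g (c j) = g (c (some i₀)) * e j) → g (c (some i₀)) ∈ nonZeroDivisors (A'.Z.presheaf.stalk ξ') →
      Ideal.span (Set.range fun j : Option (Fin 2) => if j = some i₀ then g (c (some i₀)) else e j - g (τ j)) =
        maximalIdeal (A'.Z.presheaf.stalk ξ') →
      (i₀ = 1 → τ (some 0) ∈ maximalIdeal (A.Z.presheaf.stalk (π.base ξ'))) →
      ∃ (c' : Fin 2) (b : Fin 2 → K) (E' : AdicCompletion (maximalIdeal (A'.Z.presheaf.stalk ξ')) (A'.Z.presheaf.stalk ξ') ≃+*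
          MvPowerSeries (Option (Fin 2)) K) (f' : A'.Z.presheaf.stalk ξ') (w' : MvPowerSeries (Option (Fin 2)) K),
        b c' = 0 ∧ (c' = 1 → ∀ l, b l = 0) ∧ IsEquimultiplePoint p c' b s ∧
        stalkIdeal (E.transform π D).J ξ' = Ideal.span {f'} ∧ IsUnit w' ∧
        E' (algebraMap _ _ f') = w' * (MvPowerSeries.X none ^ p + MvPolynomial.eval₂ MvPowerSeries.C
          (fun l : Fin 2 => if l = (0 : Fin 2) then MvPowerSeries.X (some (0 : Fin 2)) else MvPowerSeries.X (some 1)) (step p c' b s).F) := by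
    intro i₀ e τ he hnzd hgen hHW
    obtain ⟨f', hf'⟩ := exists_eq_pow_mul_of_mem_pow g c hc (some i₀) e he hf₀𝔪
    have hJ' : stalkIdeal (E.transform π D).J ξ' = Ideal.span {f'} :=
      stalkIdeal_transform_eq_span hπ ξ' c hcJ (some i₀) e he hnzd E f₀ hJ f' (by rw [hb]; exact hf')
    have hf'𝔪 : f' ∈ maximalIdeal (A'.Z.presheaf.stalk ξ') ^ p := by
      have h := (mem_sing_transform_iff E ξ' f' hJ').mp hξ'
      rwa [hb] at h
    obtain ⟨i₁, hi, htwo⟩ := exists_other_index i₀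
    have hHW' : i₀ = 1 → MvPowerSeries.constantCoeff (E₀ (algebraMap _ _ (τ (some 0)))) = 0 := fun h1 =>
      mem_maximalIdeal_iff_constantCoeff_eq_zero.mp (ringEquiv_mem_maximalIdeal E₀
        (by rw [AdicCompletion.maximalIdeal_eq_map]; exact Ideal.mem_map_of_mem _ (hHW h1)))
    obtain ⟨E', w', b, hw', hbc, hHWb, -, hequi, hE'⟩ := exists_ringEquiv_transform_anchor g hg E₀ c hc hcX hi htwo e he τ hgen hrat hdim
      s hdeg f₀ w hw hE₀ hHW' f' hf' hf'𝔪
    exact ⟨i₀, b, E', f', w', hbc, hHWb, hequi, hJ', hw', hE'⟩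
  -- from chart data in any `u`-chart: move to the Hauser–Wagner frame if needed (chart `u₁` at a point with `τ_{u₀}` a unit ↦ chart `u₀`)
  have tail2 : ∀ (i₀ : Fin 2) (e : Option (Fin 2) → A'.Z.presheaf.stalk ξ') (τ : Option (Fin 2) → A.Z.presheaf.stalk (π.base ξ')),
      (∀ j, g (c j) = g (c (some i₀)) * e j) → e (some i₀) = 1 → g (c (some i₀)) ∈ nonZeroDivisors (A'.Z.presheaf.stalk ξ') →
      Ideal.span (Set.range fun j : Option (Fin 2) => if j = some i₀ then g (c (some i₀)) else e j - g (τ j)) =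
        maximalIdeal (A'.Z.presheaf.stalk ξ') →
      ∃ (c' : Fin 2) (b : Fin 2 → K) (E' : AdicCompletion (maximalIdeal (A'.Z.presheaf.stalk ξ')) (A'.Z.presheaf.stalk ξ') ≃+*
          MvPowerSeries (Option (Fin 2)) K) (f' : A'.Z.presheaf.stalk ξ') (w' : MvPowerSeries (Option (Fin 2)) K),
        b c' = 0 ∧ (c' = 1 → ∀ l, b l = 0) ∧ IsEquimultiplePoint p c' b s ∧
        stalkIdeal (E.transform π D).J ξ' = Ideal.span {f'} ∧ IsUnit w' ∧
        E' (algebraMap _ _ f') = w' * (MvPowerSeries.X none ^ p + MvPolynomial.eval₂ MvPowerSeries.C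
          (fun l : Fin 2 => if l = (0 : Fin 2) then MvPowerSeries.X (some (0 : Fin 2)) else MvPowerSeries.X (some 1)) (step p c' b s).F) := by
    intro i₀ e τ he hei hnzd hgen
    by_cases hHW : i₀ = 1 → τ (some 0) ∈ maximalIdeal (A.Z.presheaf.stalk (π.base ξ'))
    · exact tail i₀ e τ he hnzd hgen hHW
    · -- `i₀ = 1` and `τ_{u₀}` is a unit: the point lies in the chart `u₀`
      rw [Classical.not_imp] at hHW
      obtain ⟨h1, hτ0⟩ := hHW
      subst h1
      have hu : IsUnit (τ (some 0)) := (IsLocalRing.notMem_maximalIdeal).mp hτ0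
      obtain ⟨e', τ', he', -, hgen'⟩ := exists_chartData_reindex g c (some (1 : Fin 2)) e he hei τ hgen (some 0) (by decide) hu
      have he0 : IsUnit (e (some 0)) := by
        refine isUnit_of_sub_mem_maximalIdeal (hu.map g) ?_
        rw [← hgen]
        exact Ideal.subset_span ⟨some 0, by dsimp only; rw [if_neg (by decide)]⟩
      have hnzd' : g (c (some 0)) ∈ nonZeroDivisors (A'.Z.presheaf.stalk ξ') := by
        rw [he (some 0)]
        exact mul_mem hnzd he0.mem_nonZeroDivisors
      exact tail 0 e' τ' he' hnzd' hgen' (fun h => absurd h (by decide))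
  -- case on the chart index delivered by the Rees chart
  cases i with
  | some i₀ => exact tail2 i₀ e τ he hei hnzd hgen
  | none =>
    by_cases hτ : ∀ j : Fin 2, τ (some j) ∈ maximalIdeal (A.Z.presheaf.stalk (π.base ξ'))
    · -- the origin of the `z`-chart is not singular
      exfalso
      obtain ⟨f', hf'⟩ := exists_eq_pow_mul_of_mem_pow g c hc none e he hf₀𝔪
      have hJ' : stalkIdeal (E.transform π D).J ξ' = Ideal.span {f'} :=
        stalkIdeal_transform_eq_span hπ ξ' c hcJ none e he hnzd E f₀ hJ f' (by rw [hb]; exact hf')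
      have hf'𝔪 : f' ∈ maximalIdeal (A'.Z.presheaf.stalk ξ') := by
        have h := (mem_sing_transform_iff E ξ' f' hJ').mp hξ'
        rw [hb] at h
        exact Ideal.pow_le_self hp.out.ne_zero h
      exact not_mem_maximalIdeal_transform_of_zChart g hg E₀ c hc hcX e he τ hgen hrat hdim hτ s.F hdeg f₀ w hw hE₀ f' hf' hf'𝔪
    · simp only [not_forall] at hτ
      obtain ⟨j₀, hj₀⟩ := hτ
      have hu : IsUnit (τ (some j₀)) := (IsLocalRing.notMem_maximalIdeal).mp hj₀
      obtain ⟨e', τ', he', hei', hgen'⟩ := exists_chartData_reindex g c none e he hei τ hgen (some j₀) (Option.some_ne_none j₀) hu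
      have hej₀ : IsUnit (e (some j₀)) := by
        refine isUnit_of_sub_mem_maximalIdeal (hu.map g) ?_
        rw [← hgen]
        exact Ideal.subset_span ⟨some j₀, by dsimp only; rw [if_neg (Option.some_ne_none j₀)]⟩
      have hnzd' : g (c (some j₀)) ∈ nonZeroDivisors (A'.Z.presheaf.stalk ξ') := by
        rw [he (some j₀)]
        exact mul_mem hnzd hej₀.mem_nonZeroDivisors
      exact tail2 j₀ e' τ' he' hei' hnzd' hgen'

end Scheme

/-! ## §5 Off the centre: the formal anchor is transported verbatim -/

section OffCentre

open CategoryTheory AlgebraicGeometry TopologicalSpace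
open Literature.AlgebraicGeometry.Hironaka2017.S02Preliminaries
open Literature.AlgebraicGeometry.Hironaka2017.Datum
open Scheme.IdealSheafData

variable {p : ℕ} [hp : Fact p.Prime] {K : Type} [Field K] [CharP K p]

/-- [OURS · L1 W4.6 rung (iii-2) — FORMAL ENTRANCE DOOR; NOT a statement of the manuscript] **Off the centre a formal anchor is carried
verbatim**: at a point `ξ′` of the blow-up NOT over the centre, the stalk map is an isomorphism and the controlled transform is the total
transform (tree `BlowupOffCentre`), so Cohen coordinates at `π ξ′` composed with the completed inverse stalk isomorphism (tree
`adicCompletionCongr`) are Cohen coordinates at `ξ′` presenting `J′_{ξ′}` by the SAME normal form. [cite: StacksProject, Tag 0804] -/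
theorem exists_formalAnchor_offCentre {A A' : AmbientDatum p K} {E : IdealExponent A.Z} {D : Closeds A.Z} (π : A'.Z ⟶ A.Z)
    (hπ : IsBlowup π (vanishingIdeal D)) {ξ' : A'.Z} (hoff : π.base ξ' ∉ (D : Set A.Z))
    (E₀ : AdicCompletion (maximalIdeal (A.Z.presheaf.stalk (π.base ξ'))) (A.Z.presheaf.stalk (π.base ξ')) ≃+*
      MvPowerSeries (Option (Fin 2)) K)
    {f₀ : A.Z.presheaf.stalk (π.base ξ')} (hJ : stalkIdeal E.J (π.base ξ') = Ideal.span {f₀}) (G : MvPowerSeries (Option (Fin 2)) K)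
    (hE₀ : E₀ (algebraMap _ _ f₀) = G) :
    ∃ (E' : AdicCompletion (maximalIdeal (A'.Z.presheaf.stalk ξ')) (A'.Z.presheaf.stalk ξ') ≃+* MvPowerSeries (Option (Fin 2)) K)
      (f' : A'.Z.presheaf.stalk ξ'), stalkIdeal (E.transform π D).J ξ' = Ideal.span {f'} ∧ E' (algebraMap _ _ f') = G := by
  classical
  haveI : IsLocallyNoetherian A'.Z := ambient_isLocallyNoetherian A'
  set ψ := (π.stalkMap ξ').hom with hψ
  have hnot : π.base ξ' ∉ (vanishingIdeal D).support := by
    rw [← SetLike.mem_coe, coe_support_vanishingIdeal]; exact hoff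
  have h1 : stalkIdeal (E.transform π D).J ξ' = (stalkIdeal E.J (π.base ξ')).map ψ := by
    show stalkIdeal (controlledTransform π (vanishingIdeal D) E.J E.b) ξ' = _
    rw [hπ.stalkIdeal_controlledTransform_of_not_mem E.J E.b hnot, stalkIdeal_comap_eq_map_stalkMap]
  haveI := hπ.isIso_stalkMap_of_not_mem_support hnot
  set eψ : A.Z.presheaf.stalk (π.base ξ') ≃+* A'.Z.presheaf.stalk ξ' := (asIso (π.stalkMap ξ')).commRingCatIsoToRingEquiv with heψ
  have heψ_apply : ∀ r, eψ r = ψ r := fun r => rfl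
  have hmax : (maximalIdeal (A.Z.presheaf.stalk (π.base ξ'))).map eψ.toRingHom = maximalIdeal (A'.Z.presheaf.stalk ξ') :=
    IsLocalRing.map_ringEquiv_maximalIdeal eψ
  set ê := adicCompletionCongr (maximalIdeal (A.Z.presheaf.stalk (π.base ξ'))) (maximalIdeal (A'.Z.presheaf.stalk ξ')) eψ hmax with hê
  refine ⟨ê.symm.trans E₀, ψ f₀, ?_, ?_⟩
  · rw [h1, hJ, Ideal.map_span, Set.image_singleton]
  · rw [RingEquiv.trans_apply, ← hE₀]
    congr 1
    rw [RingEquiv.symm_apply_eq, ← heψ_apply, hê]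
    simp only [AdicCompletion.algebraMap_apply, Algebra.algebraMap_self, RingHom.id_apply]
    rw [adicCompletionCongr_of]

end OffCentre

end MohWindowShadeFormalStep

end CampaignW46

end Summit.ResolutionOfSingularities.ResolutionOfSingularities.Theorems

end
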